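import Literature.Topology.FourManifolds.SliceKnotsFoxMilnorMetabolizer
import Literature.Topology.FourManifolds.AlexanderModuleHNN
import Literature.Topology.FourManifolds.KnotGroupMulEquivProofs
import HarnessLib

/-!
# Fox–Milnor from the Seifert–van Kampen description of the knot group

Sibling proof file of `Literature/Topology/FourManifolds/SliceKnots.lean`, for the named facts
`Literature.Topology.FourManifolds.exists_eq_mul_invert_of_isSmoothlySlice` and
`exists_eq_mul_invert_of_isTopologicallySlice` (Fox–Milnor (1966), Thm. 2). It assembles the three
algebraic files of the proof programme —

* `AlexanderModuleHNN.lean` (the Alexander module of an HNN extension is presented by `P₋ − tP₊`;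
  the algebra of Rolfsen (1976), §8.C "a Seifert matrix presents `H₁` of the infinite cyclic cover"),
* `SliceKnotsFoxMilnorProofs.lean` (metabolic `V` ⇒ `det (V − tVᵀ) = u f f̄` ⇒ every Alexander
  polynomial is `u f f̄`),
* `SliceKnotsFoxMilnorMetabolizer.lean` (a metabolizer gives the metabolic block form),

— into the reduction of the two facts to their geometric half **in Seifert–van Kampen form**: for a
(smoothly / topologically) slice knot `K` with Seifert surface `F` of genus `g` one needs (i) an
isomorphism of the knot group with the HNN extension of `G = π₁(S³ ∖ F)` along `A = π₁(F)` (the two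
push-offs), meridian ↦ stable letter (Seifert–van Kampen for the complement split along the
bicollared `F`); (ii) a `ℤ`-basis of `Gᵃᵇ = H₁(S³ ∖ F) ≅ ℤ^{2g}` dual to generators `aᵢ` of `π₁(F)`
under linking, in which the coordinates of the push-offs `aᵢ^±` are the rows / columns of the Seifert
matrix `V` (Alexander duality; Rolfsen §5.C, §8.C); (iii) a metabolizer of `V` (slice ⇒
algebraically slice, Kauffman (1987), Thm. 8.2 / Livingston (2005), Thm. 2.6). Everything downstream
of (i)–(iii) is proved.

## Main statements (all proved; no definitions, no named facts, no `sorry`)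

* `AlexanderHNN.exists_presentation_of_mulEquiv` — presentations of `Γ'/Γ''` pull back along group
  isomorphisms `Γ₀ ≃* Γ` (functoriality of the Alexander module, `KnotGroupMulEquivProofs.lean`);
* `AlexanderHNN.exists_presentation_laurent_of_mulEquiv` — the Laurent presentation `P₋ − tP₊` for
  any group isomorphic to an HNN extension;
* `Knot.exists_eq_mul_invert_of_hnn_presentation` — Fox–Milnor for a knot given (i)–(iii);
* `exists_eq_mul_invert_of_isSmoothlySlice_of_hnn_presentation`,
  `exists_eq_mul_invert_of_isTopologicallySlice_of_hnn_presentation` — the two named facts from the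
  geometric half (i)–(iii), stated as an explicit hypothesis (NOT a named fact).

## References

* R. H. Fox, J. W. Milnor, *Singularities of 2-spheres in 4-space and cobordism of knots*, Osaka
  J. Math. 3 (1966), 257–267, Thm. 2. [FoxMilnor1966]
* D. Rolfsen, *Knots and Links* (1976), §5.C (linking and Alexander duality for Seifert surfaces),
  §8.C (the Seifert matrix presents the Alexander module). [Rolfsen1976]
* L. H. Kauffman, *On Knots* (1987), Ch. VII, Ch. VIII Thm. 8.2–8.3. [Kauffman1987]
* C. Livingston, *A survey of classical knot concordance* (2005), Thm. 2.6, §3.3, §6. [Livingston2005]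
* R. Bieri, *Mayer–Vietoris sequences for HNN-groups and homological duality*, Math. Z. 143 (1975).
  [Bieri1975]
-/

open scoped LaurentPolynomial
open Function Set Matrix LaurentPolynomial HNNExtension Multiplicative

noncomputable section

namespace Literature.Topology.FourManifolds

namespace AlexanderHNN

/-! ## Transport of presentations of the Alexander module along group isomorphisms -/

/-- A presentation of `Γ'/Γ''` (an `ℤ[Γᵃᵇ]`-linear surjection `ℤ[Γᵃᵇ]ⁿ → Γ'/Γ''` with kernel spanned
by given rows) pulls back along a group isomorphism `Φ : Γ₀ ≃* Γ` to a presentation of `Γ₀'/Γ₀''`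
with the rows pulled back along `ℤ[Φᵃᵇ] : ℤ[Γ₀ᵃᵇ] ≃+* ℤ[Γᵃᵇ]` (functoriality of the Alexander
module, `exists_alexanderModule_addEquiv`; Crowell–Fox (1963), Ch. VII (4.5)–(4.6)). [folklore] -/
theorem exists_presentation_of_mulEquiv {Γ₀ : Type*} [Group Γ₀] {Γ : Type*} [Group Γ]
    (Φ : Γ₀ ≃* Γ) {n m : ℕ} (rows : Fin m → Fin n → MonoidAlgebra ℤ (Abelianization Γ))
    (π : (Fin n → MonoidAlgebra ℤ (Abelianization Γ)) →ₗ[MonoidAlgebra ℤ (Abelianization Γ)]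
      alexanderModule Γ)
    (hπ : Function.Surjective π)
    (hker : LinearMap.ker π =
      Submodule.span (MonoidAlgebra ℤ (Abelianization Γ)) (Set.range rows)) :
    ∃ π₀ : (Fin n → MonoidAlgebra ℤ (Abelianization Γ₀)) →ₗ[MonoidAlgebra ℤ (Abelianization Γ₀)]
      alexanderModule Γ₀,
      Function.Surjective π₀ ∧ LinearMap.ker π₀ =
        Submodule.span (MonoidAlgebra ℤ (Abelianization Γ₀)) (Set.range fun i j =>
          (MonoidAlgebra.mapDomainRingEquiv ℤ Φ.abelianizationCongr).symm (rows i j)) := by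
  classical
  obtain ⟨f, hf⟩ := exists_alexanderModule_addEquiv Φ
  set σ := MonoidAlgebra.mapDomainRingEquiv ℤ Φ.abelianizationCongr with hσ
  have hf' : ∀ (r : MonoidAlgebra ℤ (Abelianization Γ₀)) (y : alexanderModule Γ),
      f.symm (σ r • y) = r • f.symm y := fun r y => by
    apply f.injective
    rw [AddEquiv.apply_symm_apply, hf, AddEquiv.apply_symm_apply]
  have hrow : ∀ i, π (rows i) = 0 := fun i => by
    rw [← LinearMap.mem_ker, hker]
    exact Submodule.subset_span ⟨i, rfl⟩
  refine ⟨{ toFun := fun v => f.symm (π fun j => σ (v j))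
            map_add' := fun v w => ?_
            map_smul' := fun r v => ?_ }, ?_, le_antisymm ?_ ?_⟩
  · rw [← map_add f.symm, ← map_add π]
    congr 2
    funext j
    exact map_add σ (v j) (w j)
  · rw [RingHom.id_apply, ← hf', ← LinearMap.map_smul]
    congr 2
    funext j
    rw [Pi.smul_apply, Pi.smul_apply, smul_eq_mul, smul_eq_mul, map_mul]
  · intro y
    obtain ⟨w, hw⟩ := hπ (f y)
    refine ⟨fun j => σ.symm (w j), ?_⟩
    change f.symm (π fun j => σ (σ.symm (w j))) = y
    simp_rw [RingEquiv.apply_symm_apply]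
    rw [hw, AddEquiv.symm_apply_apply]
  · intro v hv
    rw [LinearMap.mem_ker] at hv
    change f.symm (π fun j => σ (v j)) = 0 at hv
    have hv' : π (fun j => σ (v j)) = 0 := (map_eq_zero_iff _ f.symm.injective).1 hv
    rw [← LinearMap.mem_ker, hker, Submodule.mem_span_range_iff_exists_fun] at hv'
    obtain ⟨c, hc⟩ := hv'
    have hveq : v = ∑ i, σ.symm (c i) • fun j => σ.symm (rows i j) := by
      funext j
      have h1 := congrArg (fun u : Fin n → MonoidAlgebra ℤ (Abelianization Γ) => σ.symm (u j)) hc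
      simp only [Finset.sum_apply, Pi.smul_apply, smul_eq_mul, map_sum, map_mul,
        RingEquiv.symm_apply_apply] at h1
      rw [← h1, Finset.sum_apply]
      simp only [Pi.smul_apply, smul_eq_mul]
    rw [hveq]
    exact Submodule.sum_mem _ fun i _ => Submodule.smul_mem _ _ (Submodule.subset_span ⟨i, rfl⟩)
  · rw [Submodule.span_le]
    rintro _ ⟨i, rfl⟩
    rw [SetLike.mem_coe, LinearMap.mem_ker]
    change f.symm (π fun j => σ (σ.symm (rows i j))) = 0
    simp_rw [RingEquiv.apply_symm_apply]
    rw [show (fun j => rows i j) = rows i from rfl, hrow, map_zero]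

/-- **The Laurent presentation of `Γ₀'/Γ₀''` for a group isomorphic to an HNN extension.** If
`Φ : Γ₀ ≃* HNN(G; A, φ)`, `e₀ : Γ₀ᵃᵇ ≃* ℤ` sends the class of `Φ⁻¹ t` to `1`, `b` is a `ℤ`-basis of
`Gᵃᵇ` with lifts `gⱼ`, the `aᵢ` generate `A`, and `P₊`, `P₋` are the coordinate matrices of `āᵢ`,
`φ(aᵢ)‾`, then the Alexander module of `Γ₀` has a `ℤ[Γ₀ᵃᵇ]`-linear surjective presentation
`ℤ[Γ₀ᵃᵇ]ⁿ → Γ₀'/Γ₀''` with kernel spanned by the rows of `P₋ − tP₊`, pulled back along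
`laurentEquivOfMulEquiv Γ₀ e₀`. [folklore] -/
theorem exists_presentation_laurent_of_mulEquiv {G : Type*} [Group G] {A B : Subgroup G}
    {φ : A ≃* B} {Γ₀ : Type*} [Group Γ₀] (Φ : Γ₀ ≃* HNNExtension G A B φ)
    (e₀ : Abelianization Γ₀ ≃* Multiplicative ℤ)
    (he₀ : e₀ (Abelianization.of (Φ.symm t)) = ofAdd 1)
    {n m : ℕ} (b : Module.Basis (Fin n) ℤ (Additive (Abelianization G)))
    (g : Fin n → G) (hg : ∀ j, Additive.ofMul (Abelianization.of (g j)) = b j)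
    (a : Fin m → A) (ha : Subgroup.closure (Set.range a) = ⊤) (Pp Pm : Matrix (Fin m) (Fin n) ℤ)
    (hPp : ∀ i j, b.repr (Additive.ofMul (Abelianization.of (a i : G))) j = Pp i j)
    (hPm : ∀ i j, b.repr (Additive.ofMul (Abelianization.of (φ (a i) : G))) j = Pm i j) :
    ∃ π₀ : (Fin n → MonoidAlgebra ℤ (Abelianization Γ₀)) →ₗ[MonoidAlgebra ℤ (Abelianization Γ₀)]
      alexanderModule Γ₀,
      Function.Surjective π₀ ∧ LinearMap.ker π₀ =
        Submodule.span (MonoidAlgebra ℤ (Abelianization Γ₀))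
          (Set.range ((Pm.map (C : ℤ →+* ℤ[T;T⁻¹]) - (T 1 : ℤ[T;T⁻¹]) • Pp.map (C : ℤ →+* ℤ[T;T⁻¹])).map
            (laurentEquivOfMulEquiv Γ₀ e₀).symm)) := by
  set e : Abelianization (HNNExtension G A B φ) ≃* Multiplicative ℤ :=
    Φ.abelianizationCongr.symm.trans e₀ with he_def
  have he : e (Abelianization.of t) = ofAdd 1 := by
    rw [he_def, MulEquiv.trans_apply, abelianizationCongr_symm, abelianizationCongr_of]
    exact he₀
  obtain ⟨π, hπ, hker⟩ := exists_presentation_laurent e he b g hg a ha Pp Pm hPp hPm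
  obtain ⟨π₀, hπ₀, hker₀⟩ := exists_presentation_of_mulEquiv Φ _ π hπ hker
  refine ⟨π₀, hπ₀, ?_⟩
  rw [hker₀]
  have htrans : (MonoidAlgebra.mapDomainRingEquiv ℤ Φ.abelianizationCongr).trans
      (laurentEquivOfMulEquiv (HNNExtension G A B φ) e) = laurentEquivOfMulEquiv Γ₀ e₀ := by
    rw [mapDomainRingEquiv_trans_laurentEquivOfMulEquiv]
    congr 1
    ext y
    rw [MulEquiv.trans_apply, he_def, MulEquiv.trans_apply, MulEquiv.symm_apply_apply]
  congr 2
  funext i j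
  rw [Matrix.map_apply, Matrix.map_apply, ← htrans, RingEquiv.symm_trans_apply]

end AlexanderHNN

/-! ## The knot-level statement and the two named facts -/

namespace Knot

/-- **Fox–Milnor from a Seifert–van Kampen description of the knot group.** Let `K` be a knot and
`x` a base point, and suppose given: an isomorphism `Φ` of the knot group `π₁(S³ ∖ K, x)` with an HNN
extension `HNN(G; A, φ)` (for a Seifert surface `F`: `G = π₁(S³ ∖ F)`, `A = π₁(F)`, `φ` the
identification of the two push-offs, Seifert–van Kampen), an isomorphism `e : π₁ᵃᵇ ≃* ℤ` sending the
class of the stable letter (the meridian) to `1`, a `ℤ`-basis `b` of `Gᵃᵇ` indexed by `Fin n` with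
lifts `gⱼ` (Alexander duality: `H₁(S³ ∖ F) ≅ Hom(H₁ F, ℤ) ≅ ℤ^{2g}`), generators `a₁, …, aₙ` of `A`,
and an integer matrix `V` such that the coordinates of `φ(aᵢ)‾` are the `i`-th row of `V` and those
of `āᵢ` the `i`-th column (the Seifert matrix `Vᵢⱼ = lk(aᵢ, aⱼ⁺)` in the dual basis: Rolfsen (1976),
§8.C; Kauffman (1987), Ch. VII), together with a metabolizer `U` of `V` (Kauffman (1987), Thm. 8.2).
Then every Alexander polynomial of `K` is `u · f · f(t⁻¹)`. Composition of
`AlexanderHNN.exists_presentation_laurent_of_mulEquiv` (the algebra of Rolfsen §8.C) with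
`Knot.exists_eq_mul_invert_of_seifert_presentation` (the algebra of Fox–Milnor).
[cite: Rolfsen1976, §8.C] [cite: FoxMilnor1966, Thm. 2] -/
theorem exists_eq_mul_invert_of_hnn_presentation (K : Knot) (x : K.complement)
    {G : Type*} [Group G] {A B : Subgroup G} {φ : A ≃* B}
    (Φ : K.group x ≃* HNNExtension G A B φ)
    (e : Abelianization (K.group x) ≃* Multiplicative ℤ)
    (he : e (Abelianization.of (Φ.symm t)) = ofAdd 1)
    {n : ℕ} (b : Module.Basis (Fin n) ℤ (Additive (Abelianization G))) (g : Fin n → G)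
    (hg : ∀ j, Additive.ofMul (Abelianization.of (g j)) = b j)
    (a : Fin n → A) (ha : Subgroup.closure (Set.range a) = ⊤) (V : Matrix (Fin n) (Fin n) ℤ)
    (hVp : ∀ i j, b.repr (Additive.ofMul (Abelianization.of (a i : G))) j = V j i)
    (hVm : ∀ i j, b.repr (Additive.ofMul (Abelianization.of (φ (a i) : G))) j = V i j)
    (U : Submodule ℤ (Fin n → ℤ)) (hU : 2 * Module.finrank ℤ U = n)
    (hiso : ∀ u ∈ U, ∀ w ∈ U, u ⬝ᵥ V *ᵥ w = 0)
    {Δ : ℤ[T;T⁻¹]} (hΔ : K.IsAlexanderPolynomial Δ) :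
    ∃ (f : ℤ[T;T⁻¹]) (u : ℤ[T;T⁻¹]ˣ), Δ = ↑u * f * LaurentPolynomial.invert f := by
  obtain ⟨π, hπ, hker⟩ := AlexanderHNN.exists_presentation_laurent_of_mulEquiv Φ e he b g hg a ha
    Vᵀ V (fun i j => by rw [Matrix.transpose_apply]; exact hVp i j) hVm
  refine K.exists_eq_mul_invert_of_seifert_presentation x e π hπ V ?_ U hU hiso hΔ
  rw [hker, Matrix.transpose_map]

end Knot

/-- **Reduction of the smooth Fox–Milnor fact to its geometric half, Seifert–van Kampen form.** If
every smoothly slice knot admits the data of `Knot.exists_eq_mul_invert_of_hnn_presentation` — an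
HNN description of its group over a Seifert surface with Seifert matrix `V` (Seifert–van Kampen and
Alexander duality; Rolfsen (1976), §5 and §8.C) and a metabolizer of `V` (slice ⇒ algebraically
slice; Kauffman (1987), Thm. 8.2) — then `exists_eq_mul_invert_of_isSmoothlySlice` holds. The
hypothesis is an explicit hypothesis, NOT a named fact; everything algebraic downstream of it is
proved (`AlexanderModuleHNN.lean`, `SliceKnotsFoxMilnorProofs.lean`,
`SliceKnotsFoxMilnorMetabolizer.lean`). [cite: FoxMilnor1966, Thm. 2] [cite: Rolfsen1976, §8.C] -/
theorem exists_eq_mul_invert_of_isSmoothlySlice_of_hnn_presentation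
    (h : ∀ K : Knot, K.IsSmoothlySlice →
      ∃ (x : K.complement) (G : Type) (_ : Group G) (A B : Subgroup G) (φ : A ≃* B)
        (Φ : K.group x ≃* HNNExtension G A B φ) (e : Abelianization (K.group x) ≃* Multiplicative ℤ)
        (n : ℕ) (b : Module.Basis (Fin n) ℤ (Additive (Abelianization G))) (g : Fin n → G)
        (a : Fin n → A) (V : Matrix (Fin n) (Fin n) ℤ) (U : Submodule ℤ (Fin n → ℤ)),
        e (Abelianization.of (Φ.symm t)) = ofAdd 1 ∧
        (∀ j, Additive.ofMul (Abelianization.of (g j)) = b j) ∧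
        Subgroup.closure (Set.range a) = ⊤ ∧
        (∀ i j, b.repr (Additive.ofMul (Abelianization.of (a i : G))) j = V j i) ∧
        (∀ i j, b.repr (Additive.ofMul (Abelianization.of (φ (a i) : G))) j = V i j) ∧
        2 * Module.finrank ℤ U = n ∧ ∀ u ∈ U, ∀ w ∈ U, u ⬝ᵥ V *ᵥ w = 0) :
    exists_eq_mul_invert_of_isSmoothlySlice := by
  intro K hK Δ hΔ
  obtain ⟨x, G, _, A, B, φ, Φ, e, n, b, g, a, V, U, he, hg, ha, hVp, hVm, hU, hiso⟩ := h K hK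
  exact K.exists_eq_mul_invert_of_hnn_presentation x Φ e he b g hg a ha V hVp hVm U hU hiso hΔ

/-- **Reduction of the topological Fox–Milnor fact to its geometric half, Seifert–van Kampen form**
(same statement for topologically slice knots; Livingston (2005), Thm. 2.6 with §6 for the locally
flat category). [cite: FoxMilnor1966, Thm. 2] [cite: Livingston2005, Thm. 2.6, §6] -/
theorem exists_eq_mul_invert_of_isTopologicallySlice_of_hnn_presentation
    (h : ∀ K : Knot, K.IsTopologicallySlice →
      ∃ (x : K.complement) (G : Type) (_ : Group G) (A B : Subgroup G) (φ : A ≃* B)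
        (Φ : K.group x ≃* HNNExtension G A B φ) (e : Abelianization (K.group x) ≃* Multiplicative ℤ)
        (n : ℕ) (b : Module.Basis (Fin n) ℤ (Additive (Abelianization G))) (g : Fin n → G)
        (a : Fin n → A) (V : Matrix (Fin n) (Fin n) ℤ) (U : Submodule ℤ (Fin n → ℤ)),
        e (Abelianization.of (Φ.symm t)) = ofAdd 1 ∧
        (∀ j, Additive.ofMul (Abelianization.of (g j)) = b j) ∧
        Subgroup.closure (Set.range a) = ⊤ ∧
        (∀ i j, b.repr (Additive.ofMul (Abelianization.of (a i : G))) j = V j i) ∧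
        (∀ i j, b.repr (Additive.ofMul (Abelianization.of (φ (a i) : G))) j = V i j) ∧
        2 * Module.finrank ℤ U = n ∧ ∀ u ∈ U, ∀ w ∈ U, u ⬝ᵥ V *ᵥ w = 0) :
    exists_eq_mul_invert_of_isTopologicallySlice := by
  intro K hK Δ hΔ
  obtain ⟨x, G, _, A, B, φ, Φ, e, n, b, g, a, V, U, he, hg, ha, hVp, hVm, hU, hiso⟩ := h K hK
  exact K.exists_eq_mul_invert_of_hnn_presentation x Φ e he b g hg a ha V hVp hVm U hU hiso hΔ

end Literature.Topology.FourManifolds
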